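import Summits.Ventures.Crystal3D.Theorems.StickyWulffConstantTextureLiminfTexShadowLayerRowsDefs
import Summits.Ventures.Crystal3D.Theorems.StickyWulffConstantGenericWallFloorLayerRowsApartDefs
import HarnessLib

/-!
# The plate-2 row machine is a TRANSPORT of the plate-1 row machine: `LayerRowsMachine Apart C → LayerRowsMachineTop Apartᵀ C`
# (crux `GenericWallFloor`, stmt-Ventures-19480, kernel G; lane T EDGE-ON zone architecture, cf-p1 RULING (ccxxiii)(D1)/(D2)(a): `stub_layerRowsTop` is
#  DERIVED from `stub_layerRows` by this file, for EVERY apartness predicate; machine owner 19480-p2 g14, 2026-08-29)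

HONEST FRAMING. Venture `Summits/Ventures/Crystal3D` (cell `crystal3d-full`), route `route-Ventures-StickyWulffConstant`, helper for the crux
`GenericWallFloor` (stmt-Ventures-19480) / consumer `TextureLiminfV5` (stmt-Ventures-23912).  Pure symmetry bookkeeping; standard axioms; nothing
about any named input (E1, E1h, (J-b′) …) — those stay hypotheses of R1/R1′; F-C1 not moved.

THE POINT.  The wall-cell symmetry `Φ : x ↦ basalMirror x + h·e₃` (the reflection in the mid-plane `x₃ = h/2`) is an involutive isometry of the cell
`cyl R₀ h ρ`; it swaps the plate bands `[−2R₀, −R₀] ↔ [h+R₀, h+2R₀]`, fixes the payer band `[−R₀−2, h+R₀+2]` and the lateral radius, maps a clamped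
plate `stacking L s σ` to `stacking (L ≫ basalMirror) (Φ s) σ`, preserves contact numbers, and sends the plate-2 rows toward `−e₃` (sites
`layerSite σ₂ L₂ (−e₃)`, window `[h+R₀+3, h+R₀+4]`) to the rows toward `e₃` of the mirrored plate (sites `layerSite σ₂ (L₂ ≫ basalMirror) e₃`, window
`[−R₀−4, −R₀−3]`), because `bestLayerDir`/`bestLayerPartner`/`layerSite` read the frame only through `L.symm e`.  Hence:
* `LayerRowsApartTopReg` — **the plate-2 apartness predicate** `:= LayerRowsApartReg σ₂ σ₁ (L₂ ≫ basalMirror) (L₁ ≫ basalMirror)` (the plate-1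
  regime of the mirrored pair), and in general `topReg Apart`;
* **`layerRowsMachineTop_of_machine : LayerRowsMachine Apart C → LayerRowsMachineTop (topReg Apart) C`**, in particular
  `LayerRowsMachine LayerRowsApartReg C → LayerRowsMachineTop LayerRowsApartTopReg C`.
WHAT THIS IS NOT: no proof of either machine; F-C1 not moved.
-/

noncomputable section

namespace Summit.Ventures.Crystal3D.Theorems

open Finset
open Literature.MathematicalPhysics.StatisticalMechanics (barlowPos barlowStacking IsHaggSeq basalMirror basalMirror_apply_coord
  basalMirror_basalMirror)
open Summit.Ventures.Crystal3D.Cruxes.TextureLiminf.TexShadow (E3 e₃ stacking layerRise bestLayerAxis bestLayerDir cyl LayerRowsMachine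
  LayerRowsMachineTop LayerRowsCertifiedAt LayerRowsCertifiedTopAt)
open scoped InnerProductSpace

/-! ### The transported regime -/

/-- The plate-2 regime obtained from a plate-1 regime by the cell symmetry: swap the plates and mirror the frames. -/
def topReg (Apart : (ℤ → ℤ) → (ℤ → ℤ) → (E3 ≃ₗᵢ[ℝ] E3) → (E3 ≃ₗᵢ[ℝ] E3) → Prop)
    (σ₁ σ₂ : ℤ → ℤ) (L₁ L₂ : E3 ≃ₗᵢ[ℝ] E3) : Prop :=
  Apart σ₂ σ₁ (L₂.trans basalMirror) (L₁.trans basalMirror)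

/-- **`LayerRowsApartTopReg`** — the apartness predicate of the plate-2 row machine: `LayerRowsApart` for the mirrored pair (no chain frame of plate 2's
two DOWNWARD row grains — read upward after the cell symmetry — carries plate 1's lattice or its basal twin). -/
def LayerRowsApartTopReg (σ₁ σ₂ : ℤ → ℤ) (L₁ L₂ : E3 ≃ₗᵢ[ℝ] E3) : Prop :=
  topReg LayerRowsApartReg σ₁ σ₂ L₁ L₂

/-- Unfolding. -/
theorem layerRowsApartTopReg_iff (σ₁ σ₂ : ℤ → ℤ) (L₁ L₂ : E3 ≃ₗᵢ[ℝ] E3) :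
    LayerRowsApartTopReg σ₁ σ₂ L₁ L₂ ↔ LayerRowsApart (L₂.trans basalMirror) (L₁.trans basalMirror) :=
  Iff.rfl

/-! ### The cell symmetry `Φ x = basalMirror x + h·e₃` -/

/-- `basalMirror e₃ = −e₃`. -/
theorem basalMirror_e₃ : basalMirror (e₃ : E3) = -e₃ := by
  ext t
  rw [basalMirror_apply_coord]
  show (if t = 2 then -(EuclideanSpace.single (2 : Fin 3) (1 : ℝ)) 2 else (EuclideanSpace.single (2 : Fin 3) (1 : ℝ)) t) =
    (-(EuclideanSpace.single (2 : Fin 3) (1 : ℝ))) t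
  fin_cases t <;> simp

/-- Coordinates of `Φ x`. -/
theorem cellFlip_apply_two (h : ℝ) (x : E3) : (basalMirror x + h • (e₃ : E3)) 2 = h - x 2 := by
  show basalMirror x 2 + (h • (EuclideanSpace.single (2 : Fin 3) (1 : ℝ) : E3)) 2 = h - x 2
  rw [basalMirror_apply_coord]; simp; ring

/-- Coordinates of `Φ x`. -/
theorem cellFlip_apply_zero (h : ℝ) (x : E3) : (basalMirror x + h • (e₃ : E3)) 0 = x 0 := by
  show basalMirror x 0 + (h • (EuclideanSpace.single (2 : Fin 3) (1 : ℝ) : E3)) 0 = x 0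
  rw [basalMirror_apply_coord]; simp

/-- Coordinates of `Φ x`. -/
theorem cellFlip_apply_one (h : ℝ) (x : E3) : (basalMirror x + h • (e₃ : E3)) 1 = x 1 := by
  show basalMirror x 1 + (h • (EuclideanSpace.single (2 : Fin 3) (1 : ℝ) : E3)) 1 = x 1
  rw [basalMirror_apply_coord]; simp

/-- `Φ` is an involution. -/
theorem cellFlip_cellFlip (h : ℝ) (x : E3) : basalMirror (basalMirror x + h • (e₃ : E3)) + h • (e₃ : E3) = x := by
  rw [map_add, basalMirror_basalMirror, map_smul, basalMirror_e₃, smul_neg, neg_add_cancel_right]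

/-- `Φ` is injective. -/
theorem cellFlip_injective (h : ℝ) : Function.Injective fun x : E3 => basalMirror x + h • (e₃ : E3) := fun x y hxy => by
  have := congrArg (fun z : E3 => basalMirror z + h • (e₃ : E3)) hxy
  simpa only [cellFlip_cellFlip] using this

/-- `Φ` is an isometry. -/
theorem dist_cellFlip (h : ℝ) (x y : E3) : dist (basalMirror x + h • (e₃ : E3)) (basalMirror y + h • (e₃ : E3)) = dist x y := by
  rw [dist_add_right, LinearIsometryEquiv.dist_map]

/-- `Φ` maps a clamped plate to the clamped plate of the mirrored frame: `Φ '' stacking L s σ = stacking (L ≫ basalMirror) (Φ s) σ` (pointwise). -/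
theorem cellFlip_mem_stacking_iff (h : ℝ) (L : E3 ≃ₗᵢ[ℝ] E3) (s : E3) (σ : ℤ → ℤ) (x : E3) :
    basalMirror x + h • (e₃ : E3) ∈ stacking (L.trans basalMirror) (basalMirror s + h • (e₃ : E3)) σ ↔ x ∈ stacking L s σ := by
  constructor
  · rintro ⟨r, hr, hx⟩
    refine ⟨r, hr, ?_⟩
    have hx' : basalMirror (L r) + (basalMirror s + h • (e₃ : E3)) = basalMirror x + h • (e₃ : E3) := hx
    show L r + s = x
    have := congrArg (fun z : E3 => basalMirror z + h • (e₃ : E3)) hx'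
    simp only [cellFlip_cellFlip] at this
    rw [← this, map_add, map_add, basalMirror_basalMirror, basalMirror_basalMirror, map_smul, basalMirror_e₃, smul_neg]
    abel
  · rintro ⟨r, hr, rfl⟩
    refine ⟨r, hr, ?_⟩
    show basalMirror (L r) + (basalMirror s + h • (e₃ : E3)) = basalMirror (L r + s) + h • (e₃ : E3)
    rw [map_add, add_assoc]

/-- The mirrored frame reads the vertical as the original frame reads `−e₃`: `(L ≫ basalMirror).symm e₃ = L.symm (−e₃)`. -/
theorem symm_trans_basalMirror_e₃ (L : E3 ≃ₗᵢ[ℝ] E3) : (L.trans basalMirror).symm (e₃ : E3) = L.symm (-e₃) := by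
  apply (L.trans basalMirror).injective
  rw [LinearIsometryEquiv.apply_symm_apply, LinearIsometryEquiv.trans_apply, LinearIsometryEquiv.apply_symm_apply, map_neg,
    basalMirror_e₃, neg_neg]

/-- `layerSite` reads the frame only through `L.symm e`. -/
theorem layerSite_congr {L L' : E3 ≃ₗᵢ[ℝ] E3} {e e' : E3} (hLe : L.symm e = L'.symm e') (σ : ℤ → ℤ) (k i j : ℤ) :
    layerSite σ L e k i j = layerSite σ L' e' k i j := by
  unfold layerSite bestLayerDir bestLayerPartner bestLayerAxis bestLayerPartnerAxis
  rw [hLe]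

/-- The rows of the mirrored plate toward `e₃` are the rows of plate 2 toward `−e₃`. -/
theorem layerSite_trans_basalMirror (L : E3 ≃ₗᵢ[ℝ] E3) (σ : ℤ → ℤ) (k i j : ℤ) :
    layerSite σ (L.trans basalMirror) e₃ k i j = layerSite σ L (-e₃) k i j :=
  layerSite_congr (symm_trans_basalMirror_e₃ L) σ k i j

/-- The tilt is symmetric: `⟪(L ≫ basalMirror) e₃, e₃⟫² = ⟪L e₃, e₃⟫²`. -/
theorem tilt_trans_basalMirror (L : E3 ≃ₗᵢ[ℝ] E3) : ⟪(L.trans basalMirror) e₃, (e₃ : E3)⟫_ℝ ^ 2 = ⟪L e₃, (e₃ : E3)⟫_ℝ ^ 2 := by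
  rw [LinearIsometryEquiv.trans_apply, ← LinearIsometryEquiv.inner_map_map basalMirror (basalMirror (L e₃)), basalMirror_basalMirror,
    basalMirror_e₃, inner_neg_right, neg_sq]

/-! ### Contact numbers and the payer sum under `Φ` -/

/-- Contact numbers are preserved: `#(Φ X ∩ S(Φ y, 1)) = #(X ∩ S(y, 1))`. -/
theorem card_contacts_cellFlip [DecidableEq E3] (h : ℝ) (X : Finset E3) (y : E3) :
    ((X.image fun x : E3 => basalMirror x + h • (e₃ : E3)).filter fun q => dist (basalMirror y + h • (e₃ : E3)) q = 1).card =
      (X.filter fun q => dist y q = 1).card := by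
  rw [Finset.filter_image, Finset.card_image_of_injective _ (cellFlip_injective h)]
  congr 1
  apply Finset.filter_congr
  intro q _
  simp only [dist_cellFlip]

/-- **The payer sum is symmetric**: the band `[−R₀−2, h+R₀+2]` is `Φ`-invariant and `deg` is preserved. -/
theorem paySum_cellFlip [DecidableEq E3] (h R₀ : ℝ) (X : Finset E3) :
    (∑ y ∈ (X.image fun x : E3 => basalMirror x + h • (e₃ : E3)).filter (fun y =>
        ((X.image fun x : E3 => basalMirror x + h • (e₃ : E3)).filter fun q => dist y q = 1).card ≠ 12 ∧ -R₀ - 2 ≤ y 2 ∧ y 2 ≤ h + R₀ + 2),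
      ((12 : ℝ) - (((X.image fun x : E3 => basalMirror x + h • (e₃ : E3)).filter fun q => dist y q = 1).card : ℝ))) =
    ∑ y ∈ X.filter (fun y => (X.filter fun q => dist y q = 1).card ≠ 12 ∧ -R₀ - 2 ≤ y 2 ∧ y 2 ≤ h + R₀ + 2),
      ((12 : ℝ) - ((X.filter fun q => dist y q = 1).card : ℝ)) := by
  set Φ : E3 → E3 := fun x => basalMirror x + h • (e₃ : E3) with hΦ
  have hdeg : ∀ y : E3, ((X.image Φ).filter fun q => dist (Φ y) q = 1).card = (X.filter fun q => dist y q = 1).card :=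
    fun y => card_contacts_cellFlip h X y
  have hfilt : (X.image Φ).filter (fun y => ((X.image Φ).filter fun q => dist y q = 1).card ≠ 12 ∧ -R₀ - 2 ≤ y 2 ∧ y 2 ≤ h + R₀ + 2) =
      (X.filter (fun y => (X.filter fun q => dist y q = 1).card ≠ 12 ∧ -R₀ - 2 ≤ y 2 ∧ y 2 ≤ h + R₀ + 2)).image Φ := by
    rw [Finset.filter_image]
    congr 1
    apply Finset.filter_congr
    intro y _
    show ((((X.image Φ).filter fun q => dist (Φ y) q = 1).card ≠ 12 ∧ -R₀ - 2 ≤ (Φ y) 2 ∧ (Φ y) 2 ≤ h + R₀ + 2)) ↔ _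
    rw [hdeg, hΦ, cellFlip_apply_two]
    constructor
    · rintro ⟨h1, h2, h3⟩; exact ⟨h1, by linarith, by linarith⟩
    · rintro ⟨h1, h2, h3⟩; exact ⟨h1, by linarith, by linarith⟩
  rw [hfilt, Finset.sum_image fun x _ y _ hxy => cellFlip_injective h hxy]
  apply Finset.sum_congr rfl
  intro y _
  rw [hdeg]

/-! ### The transport -/

/-- **THE PLATE-2 ROW MACHINE IS THE TRANSPORTED PLATE-1 ROW MACHINE.**  For every apartness predicate `Apart` and constant `C`:
`LayerRowsMachine Apart C → LayerRowsMachineTop (topReg Apart) C`. -/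
theorem layerRowsMachineTop_of_machine {Apart : (ℤ → ℤ) → (ℤ → ℤ) → (E3 ≃ₗᵢ[ℝ] E3) → (E3 ≃ₗᵢ[ℝ] E3) → Prop} {C : ℝ}
    (hR1 : LayerRowsMachine Apart C) : LayerRowsMachineTop (topReg Apart) C := by
  classical
  intro σ₁ σ₂ L₁ L₂ s₁ s₂ hσ₁ hσ₂ htilt hAp h hh ρ hρ X P₁ P₂ hX hP₁X hP₂X hcyl hP₁ hP₂
  set Φ : E3 → E3 := fun x => basalMirror x + h • (e₃ : E3) with hΦ
  have hΦΦ : ∀ x, Φ (Φ x) = x := fun x => cellFlip_cellFlip h x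
  have hΦ2 : ∀ x, (Φ x) 2 = h - x 2 := fun x => cellFlip_apply_two h x
  have hΦ0 : ∀ x, (Φ x) 0 = x 0 := fun x => cellFlip_apply_zero h x
  have hΦ1 : ∀ x, (Φ x) 1 = x 1 := fun x => cellFlip_apply_one h x
  have hΦinj : Function.Injective Φ := cellFlip_injective h
  -- the mirrored data
  set X' : Finset E3 := X.image Φ with hX'
  set P₁' : Finset E3 := P₂.image Φ with hP₁'
  set P₂' : Finset E3 := P₁.image Φ with hP₂'
  have hmemX' : ∀ x, x ∈ X' ↔ Φ x ∈ X := fun x => by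
    rw [hX', Finset.mem_image]
    constructor
    · rintro ⟨y, hy, rfl⟩; rw [hΦΦ]; exact hy
    · intro hx; exact ⟨Φ x, hx, hΦΦ x⟩
  have hX'sep : ∀ p ∈ X', ∀ q ∈ X', p ≠ q → 1 ≤ dist p q := by
    intro p hp q hq hne
    obtain ⟨p₀, hp₀, rfl⟩ := Finset.mem_image.1 hp
    obtain ⟨q₀, hq₀, rfl⟩ := Finset.mem_image.1 hq
    rw [show dist (Φ p₀) (Φ q₀) = dist p₀ q₀ from dist_cellFlip h p₀ q₀]
    exact hX p₀ hp₀ q₀ hq₀ fun heq => hne (by rw [heq])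
  have hdisj : ∀ p ∈ P₁, p ∉ P₂ := fun p hp hp2 => (Finset.mem_sdiff.1 (hP₂X hp2)).2 hp
  have hP₁'X : P₁' ⊆ X' := fun p hp => by
    obtain ⟨p₀, hp₀, rfl⟩ := Finset.mem_image.1 hp
    exact Finset.mem_image_of_mem _ (Finset.mem_sdiff.1 (hP₂X hp₀)).1
  have hP₂'X : P₂' ⊆ X' \ P₁' := fun p hp => by
    obtain ⟨p₀, hp₀, rfl⟩ := Finset.mem_image.1 hp
    refine Finset.mem_sdiff.2 ⟨Finset.mem_image_of_mem _ (hP₁X hp₀), fun h2 => ?_⟩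
    obtain ⟨q₀, hq₀, hq⟩ := Finset.mem_image.1 h2
    exact hdisj p₀ hp₀ (by rw [← hΦinj hq]; exact hq₀)
  have hcyl' : ∀ p ∈ X', p ∈ cyl 10 h ρ := by
    intro p hp
    obtain ⟨p₀, hp₀, rfl⟩ := Finset.mem_image.1 hp
    obtain ⟨h1, h2, h3⟩ := hcyl p₀ hp₀
    refine ⟨?_, ?_, ?_⟩
    · rw [hΦ2]; linarith
    · rw [hΦ2]; linarith
    · rw [hΦ0, hΦ1]; exact h3
  have hP₁'iff : ∀ p, p ∈ P₁' ↔ (p ∈ stacking (L₂.trans basalMirror) (Φ s₂) σ₂ ∧ -(2 * (10 : ℝ)) ≤ p 2 ∧ p 2 ≤ -10 ∧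
      p 0 ^ 2 + p 1 ^ 2 ≤ ρ ^ 2) := by
    intro p
    rw [hP₁', Finset.mem_image]
    constructor
    · rintro ⟨p₀, hp₀, rfl⟩
      obtain ⟨hs, h1, h2, h3⟩ := (hP₂ p₀).1 hp₀
      exact ⟨(cellFlip_mem_stacking_iff h L₂ s₂ σ₂ p₀).2 hs, by rw [hΦ2]; linarith, by rw [hΦ2]; linarith, by rw [hΦ0, hΦ1]; exact h3⟩
    · rintro ⟨hs, h1, h2, h3⟩
      refine ⟨Φ p, (hP₂ (Φ p)).2 ⟨?_, ?_, ?_, ?_⟩, hΦΦ p⟩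
      · rw [← cellFlip_mem_stacking_iff h L₂ s₂ σ₂ (Φ p)]; show Φ (Φ p) ∈ _; rw [hΦΦ]; exact hs
      · rw [hΦ2]; linarith
      · rw [hΦ2]; linarith
      · rw [hΦ0, hΦ1]; exact h3
  have hP₂'iff : ∀ p, p ∈ P₂' ↔ (p ∈ stacking (L₁.trans basalMirror) (Φ s₁) σ₁ ∧ h + 10 ≤ p 2 ∧ p 2 ≤ h + 2 * 10 ∧
      p 0 ^ 2 + p 1 ^ 2 ≤ ρ ^ 2) := by
    intro p
    rw [hP₂', Finset.mem_image]
    constructor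
    · rintro ⟨p₀, hp₀, rfl⟩
      obtain ⟨hs, h1, h2, h3⟩ := (hP₁ p₀).1 hp₀
      exact ⟨(cellFlip_mem_stacking_iff h L₁ s₁ σ₁ p₀).2 hs, by rw [hΦ2]; linarith, by rw [hΦ2]; linarith, by rw [hΦ0, hΦ1]; exact h3⟩
    · rintro ⟨hs, h1, h2, h3⟩
      refine ⟨Φ p, (hP₁ (Φ p)).2 ⟨?_, ?_, ?_, ?_⟩, hΦΦ p⟩
      · rw [← cellFlip_mem_stacking_iff h L₁ s₁ σ₁ (Φ p)]; show Φ (Φ p) ∈ _; rw [hΦΦ]; exact hs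
      · rw [hΦ2]; linarith
      · rw [hΦ2]; linarith
      · rw [hΦ0, hΦ1]; exact h3
  -- R1 on the mirrored data
  have htilt' : ⟪(L₂.trans basalMirror) e₃, (e₃ : E3)⟫_ℝ ^ 2 < 1 / 20 := by rw [tilt_trans_basalMirror]; exact htilt
  obtain ⟨m, T, hm, hT, hcount⟩ := hR1 σ₂ σ₁ (L₂.trans basalMirror) (L₁.trans basalMirror) (Φ s₂) (Φ s₁) hσ₂ hσ₁ htilt' hAp
    h hh ρ hρ X' P₁' P₂' hX'sep hP₁'X hP₂'X hcyl' hP₁'iff hP₂'iff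
  refine ⟨m, T, hm, fun kj ⟨i, h1, h2, h3⟩ => hT kj ⟨i, ?_⟩, ?_⟩
  · -- the plate-2 window row site is `Φ` of the mirrored window row site
    have hsite : (L₂.trans basalMirror) (layerSite σ₂ (L₂.trans basalMirror) e₃ kj.1 i kj.2) + Φ s₂ =
        Φ (L₂ (layerSite σ₂ L₂ (-e₃) kj.1 i kj.2) + s₂) := by
      rw [layerSite_trans_basalMirror, hΦ]
      simp only [LinearIsometryEquiv.trans_apply, map_add]
      abel
    rw [hsite, hΦ2, hΦ0, hΦ1]
    exact ⟨by linarith, by linarith, h3⟩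
  · rw [hX', paySum_cellFlip] at hcount
    exact hcount

/-- **In particular for R1's regime**: `LayerRowsMachine LayerRowsApartReg C → LayerRowsMachineTop LayerRowsApartTopReg C`. -/
theorem layerRowsMachineTop_of_machine_apartReg {C : ℝ} (hR1 : LayerRowsMachine LayerRowsApartReg C) :
    LayerRowsMachineTop LayerRowsApartTopReg C :=
  layerRowsMachineTop_of_machine hR1

end Summit.Ventures.Crystal3D.Theorems

end
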